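import Summits.QuantumFields.YangMills.Theorems.LuscherReductionTwistedTraceScalingBOStiffMehlerGround
import Summits.QuantumFields.YangMills.Theorems.LuscherReductionTwistedTraceScalingBOStiffGaussTail
import Summits.QuantumFields.YangMills.Theorems.LuscherReductionTwistedTraceScalingBOStiffKilledTransferSFinite
import HarnessLib

/-!
# (B-ST) flat Poincaré atom (B1): the EXIT MASS of the Mehler transition from a box, and the Mehler Poincaré inequality KILLED ON A BOX
# (lane A of S-BASE, crux `TwistedTraceScaling` stmt-QuantumFields-20203, C4-CORE, the (B-ST) pen; HANDOFF-g21 'REMAINING ANALYTIC ATOMS' (B1), hand C `…-w3`)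

The `hflat` chain of the (B-ST) door (HANDOFF-g21 UPDATE 20:57Z) is
✓`…MehlerPoincare.mehler_poincare_normal` (global, Lebesgue) → ✓`…KilledTransferSFinite.killed_transfer_sfinite` (to a window, exit mass `ε`) →
✓`…TensorPoincareSlack.variance_tensor_le_slack` → ✓R63 `killed_transfer_door` → (B3) PiDensity.  This file supplies the first analytic input, the exit mass of the flat
stiff pair `D = h₀²`, `J = h₀·K·h₀/λ₀` (`K = mehlerKernel a b`, `h₀ = hR 0`, `λ₀ = Π_k √(π/s_k)`, `s_k = a_k + b_k + π`) from the BOX `T = [−R,R]^σ`: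
(Gaussian tails: `…BOStiffGaussTail.integral_gaussShift_compl_box_le`.)
* §2 ★ `mehlerKernel_mul_hR_zero_eq_transition`: `K(x,y)h₀(y) = h₀(x)·e^{−Σ s_k(y_k − ρ_k x_k)²}`, `ρ_k = b_k/s_k` — the completed square of ✓`…MehlerGround` with the
  ground-state normalisation `a+b−b²/s = π` (`mehler_key`): the OU step from `x` is a Gaussian probability centred at the CONTRACTED point `ρx`; admissibility of the pair
  (`mehlerJ_admissible`: measurable, `0 ≤ J ≤ 2^{n/2}/λ₀`, symmetric; `D` bounded integrable), rows `∫ J(x,·) = D(x)` and `∫∫ J < ∞` (`integral_mehlerJ_right`), boxes (`box_eq_pi`, `volume_box`);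
* §3 ★★★ `mehler_exit_mass_le` — THE (B1) ESTIMATE: for `b_k/s_k ≤ ρ ≤ 1` and every `x ∈ T`: `∫_{Tᶜ} K(x,y)h₀(y)dy ≤ ε_R·λ₀·h₀(x)`, `ε_R = 2n·e^{−π(1−ρ)²R²}`, uniformly up
  to `∂T` (the box of half-width `(1−ρ)R` around `ρx` stays inside `T`: `box_subset_of_contraction`); in the door's currency ★★ `mehlerJ_exit_row`: `∫_{Tᶜ}J(x,·) ≤ ε_R D(x)` (the
  `hκ` of `killed_transfer_sfinite`) and `(1−ε_R)D(x) ≤ ∫_T J(x,·)` (the row floor `hR` of `variance_tensor_le_slack`);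
* §4 ★★★ `mehler_poincare_box` — for `0 ≤ ρ < 1`, `R > 0` and every bounded measurable `h`:
  `∫_T h²D − (∫_T hD)²/∫_T D ≤ (1/(1−ρ))·½∫_T∫_T (h(x)−h(y))²J + (ε_R/(1−ρ))·∫_T h²D` — the input `hPY` of the slack tensorisation on the finite measure space `(T, dx)`.
Next files (hand C): `…BOStiffBoxBallExit` ((B2): exit of `J ⊗ D_ZD_Z'/M_Z` from a core-stable set), `…BOStiffFlatPoincare` (the composition = `hflat` in flat coordinates).
HONEST FRAMING: classical Gaussian bookkeeping for a stub of a child of the CONDITIONAL route R2b1; (B-ST) OPEN; C4-CORE OPEN; not infinite volume, not a gap, not Clay.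

## References
* A. Wipf, *Statistical Approach to Quantum Field Theory*, LNP 992, Springer 2021, §8.5.1 (8.56)–(8.58). [Wipf2021]
* M. Fukushima, Y. Oshima, M. Takeda, *Dirichlet Forms and Symmetric Markov Processes*, de Gruyter 2011, §4.4 (part process, killing). [FukushimaOshimaTakeda2011]
-/

set_option autoImplicit false

noncomputable section

open MeasureTheory Filter
open scoped Real

namespace Summit.QuantumFields.YangMills.Theorems.FemtoTransferGap.Mehler

open Literature.Analysis.SegalBargmann

/-! ## §2 The Mehler transition density; the flat pair `D = h₀²`, `J = h₀·K·h₀/λ₀` -/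

section Transition

variable {σ : Type*} [Fintype σ] [DecidableEq σ]

omit [Fintype σ] [DecidableEq σ] in
/-- `π ≤ a_k + b_k`, hence `2π ≤ s_k = a_k + b_k + π`, under `a_k, b_k > 0`, `a_k² + 2a_kb_k = π²`. [folklore] -/
theorem two_pi_le_prec {a b : σ → ℝ} (ha : ∀ k, 0 < a k) (hb : ∀ k, 0 < b k) (hab : ∀ k, a k ^ 2 + 2 * a k * b k = π ^ 2) (k : σ) :
    2 * π ≤ a k + b k + π := by
  have h1 : π ^ 2 ≤ (a k + b k) ^ 2 := by nlinarith [hab k, sq_nonneg (b k)]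
  have h2 : π ≤ a k + b k := (pow_le_pow_iff_left₀ Real.pi_pos.le (by linarith [ha k, hb k]) two_ne_zero).1 h1
  linarith

omit [Fintype σ] [DecidableEq σ] in
/-- `0 < s_k`. [folklore] -/
theorem prec_pos {a b : σ → ℝ} (ha : ∀ k, 0 < a k) (hb : ∀ k, 0 < b k) (k : σ) : 0 < a k + b k + π := by
  have := ha k; have := hb k; positivity

omit [DecidableEq σ] in
/-- `0 < λ₀ = Π_k √(π/s_k)`. [folklore] -/
theorem lambda0_pos {a b : σ → ℝ} (ha : ∀ k, 0 < a k) (hb : ∀ k, 0 < b k) : 0 < ∏ k, Real.sqrt (π / (a k + b k + π)) :=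
  Finset.prod_pos fun k _ => Real.sqrt_pos.2 (div_pos Real.pi_pos (prec_pos ha hb k))

omit [Fintype σ] [DecidableEq σ] in
/-- `0 ≤ ρ_k = b_k/s_k`. [folklore] -/
theorem ratio_nonneg {a b : σ → ℝ} (ha : ∀ k, 0 < a k) (hb : ∀ k, 0 < b k) (k : σ) : 0 ≤ b k / (a k + b k + π) :=
  div_nonneg (hb k).le (prec_pos ha hb k).le

/-- ★ **The transition density**: `K(x,y)·h₀(y) = h₀(x)·e^{−Σ_k s_k (y_k − ρ_k x_k)²}` (`ρ_k = b_k/s_k`): the completed square of `…MehlerGround` with the ground-state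
normalisation `a_k + b_k − b_k²/s_k = π` (`mehler_key`).  The OU step from `x` is a Gaussian probability centred at the CONTRACTED point `ρx`. [cite: Wipf2021, §8.5.1 (8.56)] -/
theorem mehlerKernel_mul_hR_zero_eq_transition {a b : σ → ℝ} (ha : ∀ k, 0 < a k) (hb : ∀ k, 0 < b k) (hab : ∀ k, a k ^ 2 + 2 * a k * b k = π ^ 2)
    (x y : σ → ℝ) :
    mehlerKernel a b x y * hR 0 y = hR 0 x * Real.exp (-∑ k, (a k + b k + π) * (y k - b k / (a k + b k + π) * x k) ^ 2) := by
  have hs : ∀ k, 0 < a k + b k + π := prec_pos ha hb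
  rw [mehlerKernel_mul_hR_zero_eq hs, hR_zero_apply, mul_assoc, ← Real.exp_add]
  congr 1
  congr 1
  have hkey : ∀ k, a k + b k - b k ^ 2 / (a k + b k + π) = π := fun k => by
    rw [mehler_key (hab k)]; field_simp [(hs k).ne']; ring
  rw [neg_add_eq_sub, ← neg_sub, sub_eq_add_neg, neg_neg]
  simp only [neg_add_rev]
  rw [Finset.sum_add_distrib, Finset.mul_sum]
  have e : ∑ k, (a k + b k - b k ^ 2 / (a k + b k + π)) * x k ^ 2 = ∑ k, π * x k ^ 2 := Finset.sum_congr rfl fun k _ => by rw [hkey k]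
  rw [e]; ring

/-- `h₀` is continuous. [folklore] -/
theorem continuous_hR_zero : Continuous (hR (0 : σ →₀ ℕ) : (σ → ℝ) → ℝ) := by
  classical
  have e : (hR (0 : σ →₀ ℕ) : (σ → ℝ) → ℝ) = fun x => vacCoef σ * Real.exp (-(π * ∑ k, x k ^ 2)) := funext hR_zero_apply
  rw [e]
  fun_prop

/-- `0 < h₀(x) ≤ 2^{n/4}`. [folklore] -/
theorem hR_zero_pos_le (x : σ → ℝ) : 0 < hR 0 x ∧ hR 0 x ≤ vacCoef σ := by
  classical
  rw [hR_zero_apply]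
  refine ⟨mul_pos vacCoef_pos (Real.exp_pos _), mul_le_of_le_one_right vacCoef_pos.le (Real.exp_le_one_iff.2 (neg_nonpos.2 ?_))⟩
  exact mul_nonneg Real.pi_pos.le (Finset.sum_nonneg fun k _ => sq_nonneg _)

omit [DecidableEq σ] in
/-- `K ≤ 1` for `a, b ≥ 0`. [folklore] -/
theorem mehlerKernel_le_one {a b : σ → ℝ} (ha : ∀ k, 0 ≤ a k) (hb : ∀ k, 0 ≤ b k) (x y : σ → ℝ) : mehlerKernel a b x y ≤ 1 :=
  Real.exp_le_one_iff.2 (neg_nonpos.2 (Finset.sum_nonneg fun k _ => by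
    have := ha k; have := hb k; positivity))

/-- ★ **The flat pair is admissible**: `J = h₀Kh₀/λ₀` is jointly measurable, non-negative, symmetric and bounded by `2^{n/2}/λ₀`; `D = h₀²` is measurable,
non-negative, bounded by `2^{n/2}` and integrable. [folklore] -/
theorem mehlerJ_admissible {a b : σ → ℝ} (ha : ∀ k, 0 < a k) (hb : ∀ k, 0 < b k) :
    Measurable (Function.uncurry fun x y : σ → ℝ => hR 0 x * mehlerKernel a b x y * hR 0 y / ∏ k, Real.sqrt (π / (a k + b k + π))) ∧
    (∀ x y : σ → ℝ, 0 ≤ hR 0 x * mehlerKernel a b x y * hR 0 y / ∏ k, Real.sqrt (π / (a k + b k + π))) ∧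
    (∀ x y : σ → ℝ, hR 0 x * mehlerKernel a b x y * hR 0 y / ∏ k, Real.sqrt (π / (a k + b k + π)) =
      hR 0 y * mehlerKernel a b y x * hR 0 x / ∏ k, Real.sqrt (π / (a k + b k + π))) ∧
    (∀ x y : σ → ℝ, |hR 0 x * mehlerKernel a b x y * hR 0 y / ∏ k, Real.sqrt (π / (a k + b k + π))| ≤
      vacCoef σ ^ 2 / ∏ k, Real.sqrt (π / (a k + b k + π))) ∧
    Measurable (fun x : σ → ℝ => hR 0 x ^ 2) ∧ (∀ x : σ → ℝ, 0 ≤ hR 0 x ^ 2) ∧ (∀ x : σ → ℝ, |hR 0 x ^ 2| ≤ vacCoef σ ^ 2) ∧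
    Integrable (fun x : σ → ℝ => hR 0 x ^ 2) := by
  have hL0 := lambda0_pos ha hb
  refine ⟨?_, fun x y => ?_, fun x y => ?_, fun x y => ?_, (continuous_hR_zero.pow 2).measurable, fun x => sq_nonneg _, fun x => ?_, (memLp_hR 0).integrable_sq⟩
  · change Measurable fun p : (σ → ℝ) × (σ → ℝ) => hR 0 p.1 * mehlerKernel a b p.1 p.2 * hR 0 p.2 / ∏ k, Real.sqrt (π / (a k + b k + π))
    exact ((((continuous_hR_zero.comp continuous_fst).mul (continuous_mehlerKernel_uncurry a b)).mul (continuous_hR_zero.comp continuous_snd)).div_const _).measurable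
  · exact div_nonneg (mul_nonneg (mul_nonneg (hR_zero_pos_le x).1.le (mehlerKernel_pos a b x y).le) (hR_zero_pos_le y).1.le) hL0.le
  · rw [mehlerKernel_comm a b x y]; ring
  · have h0 : 0 ≤ hR 0 x * mehlerKernel a b x y * hR 0 y / ∏ k, Real.sqrt (π / (a k + b k + π)) :=
      div_nonneg (mul_nonneg (mul_nonneg (hR_zero_pos_le x).1.le (mehlerKernel_pos a b x y).le) (hR_zero_pos_le y).1.le) hL0.le
    rw [abs_of_nonneg h0]
    refine div_le_div_of_nonneg_right ?_ hL0.le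
    calc hR 0 x * mehlerKernel a b x y * hR 0 y ≤ vacCoef σ * 1 * vacCoef σ :=
          mul_le_mul (mul_le_mul (hR_zero_pos_le x).2 (mehlerKernel_le_one (fun k => (ha k).le) (fun k => (hb k).le) x y) (mehlerKernel_pos a b x y).le
            vacCoef_pos.le) (hR_zero_pos_le y).2 (hR_zero_pos_le y).1.le (mul_nonneg vacCoef_pos.le zero_le_one)
      _ = vacCoef σ ^ 2 := by ring
  · rw [abs_of_nonneg (sq_nonneg _), ← sq_abs, abs_of_pos (hR_zero_pos_le x).1]
    exact pow_le_pow_left₀ (hR_zero_pos_le x).1.le (hR_zero_pos_le x).2 2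

/-- ★ **Set rows of `J` in transition form**: `∫_A J(x,y) dy = (h₀(x)²/λ₀)·∫_A e^{−Σ s_k(y_k − ρ_k x_k)²} dy`. [folklore] -/
theorem setIntegral_mehlerJ_eq {a b : σ → ℝ} (ha : ∀ k, 0 < a k) (hb : ∀ k, 0 < b k) (hab : ∀ k, a k ^ 2 + 2 * a k * b k = π ^ 2) (x : σ → ℝ)
    (A : Set (σ → ℝ)) :
    ∫ y in A, hR 0 x * mehlerKernel a b x y * hR 0 y / ∏ k, Real.sqrt (π / (a k + b k + π)) =
      hR 0 x ^ 2 / (∏ k, Real.sqrt (π / (a k + b k + π))) * ∫ y in A, Real.exp (-∑ k, (a k + b k + π) * (y k - b k / (a k + b k + π) * x k) ^ 2) := by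
  rw [← integral_const_mul]
  refine integral_congr_ae (ae_of_all _ fun y => ?_)
  dsimp only
  rw [show hR 0 x * mehlerKernel a b x y * hR 0 y / ∏ k, Real.sqrt (π / (a k + b k + π)) =
      hR 0 x / (∏ k, Real.sqrt (π / (a k + b k + π))) * (mehlerKernel a b x y * hR 0 y) by ring,
    mehlerKernel_mul_hR_zero_eq_transition ha hb hab x y]
  ring

/-- ★ **Rows of `J`**: integrable, with `∫ J(x,y) dy = h₀(x)²` (the eigen-equation `Kh₀ = λ₀h₀`); `J` is integrable on `ℝ^σ × ℝ^σ` (total mass `1`). [cite: Wipf2021, §8.5.1 (8.56)] -/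
theorem integral_mehlerJ_right {a b : σ → ℝ} (ha : ∀ k, 0 < a k) (hb : ∀ k, 0 < b k) (hab : ∀ k, a k ^ 2 + 2 * a k * b k = π ^ 2) :
    (∀ x : σ → ℝ, Integrable (fun y => hR 0 x * mehlerKernel a b x y * hR 0 y / ∏ k, Real.sqrt (π / (a k + b k + π)))) ∧
    (∀ x : σ → ℝ, ∫ y, hR 0 x * mehlerKernel a b x y * hR 0 y / ∏ k, Real.sqrt (π / (a k + b k + π)) = hR 0 x ^ 2) ∧
    Integrable (Function.uncurry fun x y : σ → ℝ => hR 0 x * mehlerKernel a b x y * hR 0 y / ∏ k, Real.sqrt (π / (a k + b k + π)))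
      ((volume : Measure (σ → ℝ)).prod volume) := by
  have hs : ∀ k, 0 < a k + b k + π := prec_pos ha hb
  have hL0 := lambda0_pos ha hb
  have erow : ∀ x : σ → ℝ, (fun y => hR 0 x * mehlerKernel a b x y * hR 0 y / ∏ k, Real.sqrt (π / (a k + b k + π))) =
      fun y => hR 0 x ^ 2 / (∏ k, Real.sqrt (π / (a k + b k + π))) * Real.exp (-∑ k, (a k + b k + π) * (y k - b k / (a k + b k + π) * x k) ^ 2) :=
    fun x => funext fun y => by
      rw [show hR 0 x * mehlerKernel a b x y * hR 0 y / ∏ k, Real.sqrt (π / (a k + b k + π)) =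
          hR 0 x / (∏ k, Real.sqrt (π / (a k + b k + π))) * (mehlerKernel a b x y * hR 0 y) by ring,
        mehlerKernel_mul_hR_zero_eq_transition ha hb hab x y]
      ring
  refine ⟨fun x => ?_, fun x => ?_, ?_⟩
  · rw [erow x]
    exact (integral_gaussShift hs _).1.const_mul _
  · rw [erow x, integral_const_mul, (integral_gaussShift hs _).2]
    field_simp
  · have h0 : MemLp (hR (0 : σ →₀ ℕ)) 2 (volume : Measure (σ → ℝ)) := memLp_hR 0
    have h := (integrable_mehlerForm_integrand ha (fun k => (hb k).le) h0 h0).div_const (∏ k, Real.sqrt (π / (a k + b k + π)))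
    exact h

omit [Fintype σ] [DecidableEq σ] in
/-- The box `{|y_k − m_k| ≤ t ∀k}` is the product of intervals; it is measurable. [folklore] -/
theorem box_eq_pi (m : σ → ℝ) (t : ℝ) : {y : σ → ℝ | ∀ k, |y k - m k| ≤ t} = Set.pi Set.univ fun k => Set.Icc (m k - t) (m k + t) := by
  ext y
  simp only [Set.mem_setOf_eq, Set.mem_pi, Set.mem_univ, forall_const, Set.mem_Icc, abs_le]
  exact forall_congr' fun k => by constructor <;> intro h <;> constructor <;> linarith [h.1, h.2]

omit [Fintype σ] [DecidableEq σ] in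
/-- The box is measurable. [folklore] -/
theorem measurableSet_box [Countable σ] (m : σ → ℝ) (t : ℝ) : MeasurableSet {y : σ → ℝ | ∀ k, |y k - m k| ≤ t} := by
  rw [box_eq_pi]
  exact MeasurableSet.univ_pi fun k => measurableSet_Icc

omit [DecidableEq σ] in
/-- The box has finite, and for `t > 0` positive, Lebesgue measure. [folklore] -/
theorem volume_box (m : σ → ℝ) {t : ℝ} (ht : 0 < t) :
    volume {y : σ → ℝ | ∀ k, |y k - m k| ≤ t} < ⊤ ∧ 0 < volume {y : σ → ℝ | ∀ k, |y k - m k| ≤ t} := by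
  rw [box_eq_pi, volume_pi_pi]
  simp only [Real.volume_Icc]
  refine ⟨ENNReal.prod_lt_top fun k _ => ENNReal.ofReal_lt_top, pos_iff_ne_zero.2 (Finset.prod_ne_zero_iff.2 fun k _ => (ENNReal.ofReal_pos.2 (by linarith)).ne')⟩

end Transition

/-! ## §3 ★★★ (B1) The exit mass from a box and the row mass inside it -/

section Exit

variable {σ : Type*} [Fintype σ] [DecidableEq σ]

omit [Fintype σ] [DecidableEq σ] in
/-- **Contraction keeps the box**: if `|x_k| ≤ R` for all `k` and `0 ≤ ρ_k ≤ ρ ≤ 1`, the box of half-width `(1−ρ)R` around `(ρ_k x_k)_k` lies in `[−R,R]^σ`. [folklore] -/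
theorem box_subset_of_contraction {r : σ → ℝ} (hr0 : ∀ k, 0 ≤ r k) {ρ : ℝ} (hr : ∀ k, r k ≤ ρ) {R : ℝ} {x : σ → ℝ}
    (hx : ∀ k, |x k| ≤ R) : {y : σ → ℝ | ∀ k, |y k - r k * x k| ≤ (1 - ρ) * R} ⊆ {y : σ → ℝ | ∀ k, |y k - 0| ≤ R} := by
  intro y hy k
  have h1 := hy k
  have h2 : |r k * x k| ≤ ρ * R := by
    rw [abs_mul, abs_of_nonneg (hr0 k)]; exact mul_le_mul (hr k) (hx k) (abs_nonneg _) ((hr0 k).trans (hr k))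
  rw [sub_zero]
  calc |y k| = |(y k - r k * x k) + r k * x k| := by ring_nf
    _ ≤ |y k - r k * x k| + |r k * x k| := abs_add_le _ _
    _ ≤ (1 - ρ) * R + ρ * R := add_le_add h1 h2
    _ = R := by ring

omit [DecidableEq σ] in
/-- The explicit tail sum is at most `2·n·e^{−πt²}` (`s_k ≥ 2π`). [folklore] -/
theorem tailSum_le {a b : σ → ℝ} (ha : ∀ k, 0 < a k) (hb : ∀ k, 0 < b k) (hab : ∀ k, a k ^ 2 + 2 * a k * b k = π ^ 2) (t : ℝ) :
    Real.sqrt 2 * ∑ j, Real.exp (-((a j + b j + π) / 2 * t ^ 2)) ≤ 2 * Fintype.card σ * Real.exp (-(π * t ^ 2)) := by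
  have h1 : ∀ j, Real.exp (-((a j + b j + π) / 2 * t ^ 2)) ≤ Real.exp (-(π * t ^ 2)) := fun j => by
    refine Real.exp_le_exp.2 (neg_le_neg (mul_le_mul_of_nonneg_right ?_ (sq_nonneg t)))
    linarith [two_pi_le_prec ha hb hab j]
  have h2 : ∑ j, Real.exp (-((a j + b j + π) / 2 * t ^ 2)) ≤ Fintype.card σ * Real.exp (-(π * t ^ 2)) := by
    calc ∑ j, Real.exp (-((a j + b j + π) / 2 * t ^ 2)) ≤ ∑ _j : σ, Real.exp (-(π * t ^ 2)) := Finset.sum_le_sum fun j _ => h1 j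
      _ = Fintype.card σ * Real.exp (-(π * t ^ 2)) := by rw [Finset.sum_const, nsmul_eq_mul, Finset.card_univ]
  have hsqrt : Real.sqrt 2 ≤ 2 := by
    rw [show (2 : ℝ) = Real.sqrt (2 ^ 2) by rw [Real.sqrt_sq (by norm_num : (0:ℝ) ≤ 2)]]
    exact Real.sqrt_le_sqrt (by norm_num)
  have h0 : 0 ≤ ∑ j, Real.exp (-((a j + b j + π) / 2 * t ^ 2)) := Finset.sum_nonneg fun j _ => (Real.exp_pos _).le
  calc Real.sqrt 2 * ∑ j, Real.exp (-((a j + b j + π) / 2 * t ^ 2)) ≤ 2 * (Fintype.card σ * Real.exp (-(π * t ^ 2))) :=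
        mul_le_mul hsqrt h2 h0 (by norm_num)
    _ = 2 * Fintype.card σ * Real.exp (-(π * t ^ 2)) := by ring

/-- ★★★ **(B1) THE EXIT MASS OF THE MEHLER TRANSITION FROM A BOX IS UNIFORMLY SMALL UP TO THE BOUNDARY.**  `a_k, b_k > 0`, `a_k² + 2a_kb_k = π²`, `b_k/s_k ≤ ρ ≤ 1`,
`T = [−R,R]^σ`.  For every `x ∈ T`:  `∫_{Tᶜ} K(x,y)h₀(y) dy ≤ 2n·e^{−π(1−ρ)²R²}·λ₀·h₀(x)` — because the transition from `x` is centred at the contracted point `ρx`,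
at distance `≥ (1−ρ)R` from `∂T` in every coordinate. [folklore] -/
theorem mehler_exit_mass_le {a b : σ → ℝ} (ha : ∀ k, 0 < a k) (hb : ∀ k, 0 < b k) (hab : ∀ k, a k ^ 2 + 2 * a k * b k = π ^ 2) {ρ : ℝ}
    (hρ : ∀ k, b k / (a k + b k + π) ≤ ρ) (hρ1 : ρ ≤ 1) {R : ℝ} (hRnn : 0 ≤ R) {x : σ → ℝ} (hx : ∀ k, |x k| ≤ R) :
    ∫ y in {y : σ → ℝ | ∀ k, |y k - 0| ≤ R}ᶜ, mehlerKernel a b x y * hR 0 y ≤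
      (2 * Fintype.card σ * Real.exp (-(π * ((1 - ρ) * R) ^ 2))) * ((∏ k, Real.sqrt (π / (a k + b k + π))) * hR 0 x) := by
  have hs : ∀ k, 0 < a k + b k + π := prec_pos ha hb
  have ht : 0 ≤ (1 - ρ) * R := mul_nonneg (by linarith) hRnn
  have h0x := (hR_zero_pos_le x).1
  set m : σ → ℝ := fun k => b k / (a k + b k + π) * x k with hm
  obtain ⟨hi, -⟩ := integral_gaussShift hs m
  -- transition form
  have e : ∫ y in {y : σ → ℝ | ∀ k, |y k - 0| ≤ R}ᶜ, mehlerKernel a b x y * hR 0 y =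
      hR 0 x * ∫ y in {y : σ → ℝ | ∀ k, |y k - 0| ≤ R}ᶜ, Real.exp (-∑ k, (a k + b k + π) * (y k - m k) ^ 2) := by
    rw [← integral_const_mul]
    exact integral_congr_ae (ae_of_all _ fun y => mehlerKernel_mul_hR_zero_eq_transition ha hb hab x y)
  rw [e]
  -- `Tᶜ ⊆ (ρx + [−(1−ρ)R, (1−ρ)R]^σ)ᶜ`
  have hsub : {y : σ → ℝ | ∀ k, |y k - 0| ≤ R}ᶜ ⊆ {y : σ → ℝ | ∀ k, |y k - m k| ≤ (1 - ρ) * R}ᶜ :=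
    Set.compl_subset_compl.2 (box_subset_of_contraction (ratio_nonneg ha hb) hρ hx)
  have hmono : ∫ y in {y : σ → ℝ | ∀ k, |y k - 0| ≤ R}ᶜ, Real.exp (-∑ k, (a k + b k + π) * (y k - m k) ^ 2) ≤
      ∫ y in {y : σ → ℝ | ∀ k, |y k - m k| ≤ (1 - ρ) * R}ᶜ, Real.exp (-∑ k, (a k + b k + π) * (y k - m k) ^ 2) :=
    setIntegral_mono_set hi.integrableOn (ae_of_all _ fun y => (Real.exp_pos _).le) (ae_of_all _ hsub)
  have htail := integral_gaussShift_compl_box_le hs m ht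
  have hsum := tailSum_le ha hb hab ((1 - ρ) * R)
  have hL0 := lambda0_pos ha hb
  calc hR 0 x * ∫ y in {y : σ → ℝ | ∀ k, |y k - 0| ≤ R}ᶜ, Real.exp (-∑ k, (a k + b k + π) * (y k - m k) ^ 2)
      ≤ hR 0 x * (Real.sqrt 2 * (∑ j, Real.exp (-((a j + b j + π) / 2 * ((1 - ρ) * R) ^ 2))) * ∏ k, Real.sqrt (π / (a k + b k + π))) :=
        mul_le_mul_of_nonneg_left (hmono.trans htail) h0x.le
    _ ≤ hR 0 x * ((2 * Fintype.card σ * Real.exp (-(π * ((1 - ρ) * R) ^ 2))) * ∏ k, Real.sqrt (π / (a k + b k + π))) :=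
        mul_le_mul_of_nonneg_left (mul_le_mul_of_nonneg_right hsum hL0.le) h0x.le
    _ = _ := by ring

/-- ★★★ **(B1) in the door's currency**: with `D = h₀²`, `J = h₀Kh₀/λ₀`, `ε = 2n·e^{−π(1−ρ)²R²}` and `T = [−R,R]^σ`: for every `x ∈ T`,
`∫_{Tᶜ} J(x,y) dy ≤ ε·D(x)` (the exit-mass hypothesis `hκ` of `…KilledTransferSFinite.killed_transfer_sfinite`) and `(1 − ε)·D(x) ≤ ∫_T J(x,y) dy` (the row lower bound
`hR` of `…TensorPoincareSlack.variance_tensor_le_slack`). [folklore] -/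
theorem mehlerJ_exit_row {a b : σ → ℝ} (ha : ∀ k, 0 < a k) (hb : ∀ k, 0 < b k) (hab : ∀ k, a k ^ 2 + 2 * a k * b k = π ^ 2) {ρ : ℝ}
    (hρ : ∀ k, b k / (a k + b k + π) ≤ ρ) (hρ1 : ρ ≤ 1) {R : ℝ} (hRnn : 0 ≤ R) {x : σ → ℝ} (hx : ∀ k, |x k - 0| ≤ R) :
    ∫ y in {y : σ → ℝ | ∀ k, |y k - 0| ≤ R}ᶜ, hR 0 x * mehlerKernel a b x y * hR 0 y / ∏ k, Real.sqrt (π / (a k + b k + π)) ≤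
      (2 * Fintype.card σ * Real.exp (-(π * ((1 - ρ) * R) ^ 2))) * hR 0 x ^ 2 ∧
    (1 - 2 * Fintype.card σ * Real.exp (-(π * ((1 - ρ) * R) ^ 2))) * hR 0 x ^ 2 ≤
      ∫ y in {y : σ → ℝ | ∀ k, |y k - 0| ≤ R}, hR 0 x * mehlerKernel a b x y * hR 0 y / ∏ k, Real.sqrt (π / (a k + b k + π)) := by
  have hL0 := lambda0_pos ha hb
  have h0x := (hR_zero_pos_le x).1
  have hx' : ∀ k, |x k| ≤ R := fun k => by simpa using hx k
  have hexit := mehler_exit_mass_le ha hb hab hρ hρ1 hRnn hx'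
  obtain ⟨hJx, hrow, -⟩ := integral_mehlerJ_right ha hb hab
  -- exit in `J`-currency
  have e1 : ∫ y in {y : σ → ℝ | ∀ k, |y k - 0| ≤ R}ᶜ, hR 0 x * mehlerKernel a b x y * hR 0 y / ∏ k, Real.sqrt (π / (a k + b k + π)) =
      hR 0 x / (∏ k, Real.sqrt (π / (a k + b k + π))) * ∫ y in {y : σ → ℝ | ∀ k, |y k - 0| ≤ R}ᶜ, mehlerKernel a b x y * hR 0 y := by
    rw [← integral_const_mul]
    exact integral_congr_ae (ae_of_all _ fun y => by ring)
  have hexit' : ∫ y in {y : σ → ℝ | ∀ k, |y k - 0| ≤ R}ᶜ, hR 0 x * mehlerKernel a b x y * hR 0 y / ∏ k, Real.sqrt (π / (a k + b k + π)) ≤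
      (2 * Fintype.card σ * Real.exp (-(π * ((1 - ρ) * R) ^ 2))) * hR 0 x ^ 2 := by
    rw [e1]
    calc hR 0 x / (∏ k, Real.sqrt (π / (a k + b k + π))) * ∫ y in {y : σ → ℝ | ∀ k, |y k - 0| ≤ R}ᶜ, mehlerKernel a b x y * hR 0 y
        ≤ hR 0 x / (∏ k, Real.sqrt (π / (a k + b k + π))) *
            ((2 * Fintype.card σ * Real.exp (-(π * ((1 - ρ) * R) ^ 2))) * ((∏ k, Real.sqrt (π / (a k + b k + π))) * hR 0 x)) :=
          mul_le_mul_of_nonneg_left hexit (div_nonneg h0x.le hL0.le)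
      _ = (2 * Fintype.card σ * Real.exp (-(π * ((1 - ρ) * R) ^ 2))) * hR 0 x ^ 2 := by field_simp
  refine ⟨hexit', ?_⟩
  -- row = total − exit
  have hsplit := integral_add_compl (measurableSet_box (fun _ : σ => (0 : ℝ)) R) (hJx x)
  rw [hrow x] at hsplit
  linarith

end Exit

/-! ## §4 ★★★ The Mehler Poincaré inequality killed on a box (input `hPY` of the slack tensorisation) -/

section Box

variable {σ : Type*} [Fintype σ] [DecidableEq σ]

/-- ★★★ **MEHLER POINCARÉ ON A BOX WITH KILLING SLACK.**  `a_k, b_k > 0`, `a_k² + 2a_kb_k = π²`, `0 ≤ ρ < 1`, `b_k/s_k ≤ ρ`, `R > 0`, `T = [−R,R]^σ`, `D = h₀²`, `J = h₀Kh₀/λ₀`,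
`ε = 2n·e^{−π(1−ρ)²R²}`.  For every bounded measurable `h`:
`∫_T h²D − (∫_T hD)²/∫_T D ≤ (1/(1−ρ))·½∫_T∫_T (h(x)−h(y))²J + (1/(1−ρ))·ε·∫_T h²D`
(✓`mehler_poincare_normal` → ✓`killed_transfer_sfinite` with the exit mass of §3). [cite: Wipf2021, §8.5.1 (8.58)] -/
theorem mehler_poincare_box {a b : σ → ℝ} (ha : ∀ k, 0 < a k) (hb : ∀ k, 0 < b k) (hab : ∀ k, a k ^ 2 + 2 * a k * b k = π ^ 2)
    {ρ : ℝ} (hρ0 : 0 ≤ ρ) (hρ : ∀ k, b k / (a k + b k + π) ≤ ρ) (hρ1 : ρ < 1) {R : ℝ} (hRpos : 0 < R)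
    {h : (σ → ℝ) → ℝ} (hh : Measurable h) {Ch : ℝ} (hhb : ∀ x, |h x| ≤ Ch) :
    (∫ x in {y : σ → ℝ | ∀ k, |y k - 0| ≤ R}, h x ^ 2 * hR 0 x ^ 2) -
        (∫ x in {y : σ → ℝ | ∀ k, |y k - 0| ≤ R}, h x * hR 0 x ^ 2) ^ 2 / (∫ x in {y : σ → ℝ | ∀ k, |y k - 0| ≤ R}, hR 0 x ^ 2) ≤
      (1 / (1 - ρ)) * ((1 / 2) * ∫ x in {y : σ → ℝ | ∀ k, |y k - 0| ≤ R}, ∫ y in {y : σ → ℝ | ∀ k, |y k - 0| ≤ R},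
          (h x - h y) ^ 2 * (hR 0 x * mehlerKernel a b x y * hR 0 y / ∏ k, Real.sqrt (π / (a k + b k + π)))) +
        (1 / (1 - ρ)) * (2 * Fintype.card σ * Real.exp (-(π * ((1 - ρ) * R) ^ 2))) *
          ∫ x in {y : σ → ℝ | ∀ k, |y k - 0| ≤ R}, h x ^ 2 * hR 0 x ^ 2 := by
  obtain ⟨hJm, hJ0, hJsymm, -, hDm, hD0, -, hDint⟩ := mehlerJ_admissible ha hb
  obtain ⟨hJx, -, hJint⟩ := integral_mehlerJ_right ha hb hab
  have hT := measurableSet_box (fun _ : σ => (0 : ℝ)) R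
  -- `0 < ∫_T D`
  have hZT : 0 < ∫ x in {y : σ → ℝ | ∀ k, |y k - 0| ≤ R}, hR 0 x ^ 2 := by
    rw [integral_pos_iff_support_of_nonneg_ae (ae_of_all _ fun x => sq_nonneg (hR 0 x)) hDint.integrableOn]
    have hsupp : Function.support (fun x : σ → ℝ => hR 0 x ^ 2) = Set.univ :=
      Set.eq_univ_of_forall fun x => by rw [Function.mem_support]; exact (pow_pos (hR_zero_pos_le x).1 2).ne'
    rw [hsupp, Measure.restrict_apply_univ]
    exact (volume_box (fun _ : σ => (0 : ℝ)) hRpos).2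
  have hP₀ : 0 ≤ 1 / (1 - ρ) := div_nonneg zero_le_one (by linarith)
  exact StiffDoor.killed_transfer_sfinite (μ := (volume : Measure (σ → ℝ))) hJm hJ0 hJsymm hJx hJint hDm hD0 hDint hT hZT hP₀
    (fun x hx => (mehlerJ_exit_row ha hb hab hρ hρ1.le hRpos.le hx).1)
    (fun g hg ⟨C, hC⟩ => mehler_poincare_normal ha hb hab hρ0 hρ hρ1 hg hC) hh hhb

end Box

end Summit.QuantumFields.YangMills.Theorems.FemtoTransferGap.Mehler

end
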